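import Summits.QuantumFields.YangMills.Theses.TransportPerturbation
import Summits.QuantumFields.YangMills.Theorems.CutoffNotchTransportHistoryTailOfNotchRated
import Literature.MathematicalPhysics.QuantumFieldTheory.Balaban1983to89.T3FinestHeightTail

/-!
# Route `TransportPerturbation`, LINE «regular_shadow» (planner seat ym-idea-5 g8, on crux K2 `WeightedAlmostInvariance` stmt-QuantumFields-26987):
# support item `TopRegularMass` (stmt-QuantumFields-27783) — the TOP-REGULAR MASS is summable in square root

Width seat ym-line-sfw-p2-w2 g20 (cell `ym-idea-1`, free hands).  Rung R3 of LADDER-YM is a RECORD rung: no summit, no continuum limit and no mass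
gap is proved by this file; the line's load-bearing item `RegularWindowShadow` (stmt-QuantumFields-27784) is untouched.

WHAT.  For every exponent `0 < a < 1/2`, every three-torus family `F` and every `γ > 0` the profile
`e_K := E·(γ ε_{K+1})²` (`ε_{K+1} = L^{−(K+1)}`, so `e_K = E·β_{K+1}^{−2}` with `β_{K+1} = (γ ε_{K+1})⁻¹` the bare inverse coupling of the
`(K+1)`-st approximation) bounds the Gibbs mass of the fine configurations having SOME bare plaquette with `dist1(U(∂p)) ≥ θ_K := (γ ε_{K+1})^a`,
and `√e_K = √E·γ·L^{−(K+1)}` is summable (geometric).  Here `E = 1 + C₁·144·e^{24}·c⁻³·L^{3m_F}·γ³` with `c` the Haar small-ball constant of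
`T3FinestHeightTail.gibbsMeasure_real_dist1_ge_le` and `C₁ = 4^n·n!`, `n = ⌈(19/2)/(1 − 2a)⌉`.

THE ARGUMENT (bookkeeping over two tree theorems).
* If `β = β_{K+1} ≥ 1`: the single-plaquette tail `Gibbs{θ ≤ dist1(U(∂p))} ≤ 2e^{24}c⁻³(√β)^9·e^{−βθ²/4}` (reflection positivity + chessboard +
  small balls, `T3FinestHeightTail.gibbsMeasure_real_dist1_ge_le` at `d = 3`, `N = 2`), the union bound over the `≤ 72·L^{3m_F}·(L^{K+1})³ = 72·L^{3m_F}·γ³β³`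
  bare plaquettes (`CutoffNotchTransport.card_plaq_le_height`), the identity `β·θ_K² = β^{1−2a}` and «stretched exponential beats any power»
  (`β^{19/2}·e^{−β^{1−2a}/4} ≤ C₁`, from `y^n/n! ≤ e^y`) give mass `≤ 144·e^{24}c⁻³·L^{3m_F}·γ³·C₁·β^{−2} ≤ e_K`.
* If `β < 1` (finitely many `K`): mass `≤ 1 ≤ E ≤ E·β^{−2} = e_K`.

References: L. Gross, *Convergence of U(1)₃ lattice gauge theory to its continuum limit*, CMP **92** (1983) 137–162 (Thm 3.6: the abelian template of
the bare plaquette tail); J. Fröhlich, R. Israel, E. Lieb, B. Simon, CMP **62** (1978) 1–34 (chessboard estimate); T. Bałaban, CMP **102** (1985)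
255–275 [Balaban1985UV3] ((0.18)/(7): the bare small-field characteristic functions).
-/

set_option autoImplicit false

noncomputable section

open MeasureTheory
open scoped BigOperators

namespace Summit.QuantumFields.YangMills.Theorems.TransportPerturbationRegularShadow

open Literature.MathematicalPhysics.QuantumFieldTheory
open Literature.MathematicalPhysics.QuantumFieldTheory.Balaban1983to89
open Literature.MathematicalPhysics.QuantumFieldTheory.Balaban1983to89.T3ContinuumYM3Torus
open Literature.MathematicalPhysics.QuantumFieldTheory.Balaban1983to89.T3CruxEstimates (real_not_plaqSmall_comp_le_sum)
open Literature.MathematicalPhysics.QuantumFieldTheory.Balaban1983to89.T3FinestHeightTail (gibbsMeasure_real_dist1_ge_le)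
open Summit.QuantumFields.YangMills.Theorems.CutoffNotchTransport (card_plaq_le_height)

/-! ## §1 Arithmetic: stretched exponentials beat powers -/

/-- **Stretched exponential beats any power**: for `0 < s` and `0 ≤ q` there is `C ≥ 0` (`C = 4^n·n!`, `n = ⌈q/s⌉`) with
`x^q·e^{−x^s/4} ≤ C` for every `x ≥ 1`. [folklore] -/
theorem rpow_mul_exp_neg_rpow_le {s q : ℝ} (hs : 0 < s) (hq : 0 ≤ q) :
    ∃ C : ℝ, 0 ≤ C ∧ ∀ x : ℝ, 1 ≤ x → x ^ q * Real.exp (-(x ^ s / 4)) ≤ C := by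
  obtain ⟨n, hn⟩ : ∃ n : ℕ, q / s ≤ n := ⟨⌈q / s⌉₊, Nat.le_ceil _⟩
  refine ⟨(4 : ℝ) ^ n * n.factorial, by positivity, fun x hx => ?_⟩
  have hx0 : 0 < x := one_pos.trans_le hx
  have hqsn : q ≤ s * (n : ℝ) := by rw [mul_comm]; exact (div_le_iff₀ hs).mp hn
  have h1 : x ^ q ≤ x ^ (s * (n : ℝ)) := Real.rpow_le_rpow_of_exponent_le hx hqsn
  have h2 : x ^ (s * (n : ℝ)) = (x ^ s) ^ n := by rw [Real.rpow_mul hx0.le, Real.rpow_natCast]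
  have hy : 0 ≤ x ^ s / 4 := by positivity
  have h3 : (x ^ s) ^ n = 4 ^ n * (x ^ s / 4) ^ n := by
    rw [← mul_pow]; congr 1; ring
  have h4 : (x ^ s / 4) ^ n ≤ (n.factorial : ℝ) * Real.exp (x ^ s / 4) := by
    -- one Taylor term of the exponential: `y^n / n! ≤ e^y` (tree twin: `Iwaniec1980b.pow_le_factorial_mul_exp`)
    have h := Real.pow_div_factorial_le_exp (x := x ^ s / 4) hy n
    have hn : (0 : ℝ) < n.factorial := by exact_mod_cast n.factorial_pos
    calc (x ^ s / 4) ^ n ≤ Real.exp (x ^ s / 4) * n.factorial := (div_le_iff₀ hn).mp h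
      _ = (n.factorial : ℝ) * Real.exp (x ^ s / 4) := mul_comm _ _
  have hE : 0 < Real.exp (x ^ s / 4) := Real.exp_pos _
  have _hq := hq
  rw [Real.exp_neg, ← div_eq_mul_inv, div_le_iff₀ hE]
  calc x ^ q ≤ x ^ (s * (n : ℝ)) := h1
    _ = 4 ^ n * (x ^ s / 4) ^ n := by rw [h2, h3]
    _ ≤ 4 ^ n * ((n.factorial : ℝ) * Real.exp (x ^ s / 4)) := by gcongr
    _ = 4 ^ n * (n.factorial : ℝ) * Real.exp (x ^ s / 4) := by ring

/-- The threshold identity: with `β = t⁻¹` and `θ = t^a` (`t = γ ε > 0`), `β·θ² = β^{1−2a}`. [folklore] -/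
theorem inv_mul_rpow_sq {t a : ℝ} (ht : 0 < t) : t⁻¹ * (t ^ a) ^ 2 = t⁻¹ ^ (1 - 2 * a) := by
  have h1 : t ^ (a * 2) = (t ^ a) ^ 2 := by rw [Real.rpow_mul ht.le, Real.rpow_two]
  rw [← h1, ← Real.rpow_neg_one, ← Real.rpow_add ht, ← Real.rpow_mul ht.le]
  congr 1; ring

/-- The power bookkeeping `β³·(√β)⁹ = β^{19/2}·β^{−2}` (`β > 0`). [folklore] -/
theorem pow_three_mul_sqrt_pow_nine {β : ℝ} (hβ : 0 < β) :
    β ^ 3 * Real.sqrt β ^ 9 = β ^ (19 / 2 : ℝ) * β ^ (-2 : ℝ) := by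
  have h1 : Real.sqrt β ^ 9 = β ^ (9 / 2 : ℝ) := by
    rw [Real.sqrt_eq_rpow, ← Real.rpow_natCast, ← Real.rpow_mul hβ.le]; norm_num
  have h2 : β ^ 3 = β ^ (3 : ℝ) := by rw [← Real.rpow_natCast]; norm_num
  rw [h1, h2, ← Real.rpow_add hβ, ← Real.rpow_add hβ]; norm_num

/-! ## §2 The support item -/

/-- ★★ **`TopRegularMass` HOLDS** (support item stmt-QuantumFields-27783 of route `TransportPerturbation`, LINE «regular_shadow»): for every
`0 < a < 1/2`, every family `F` and every `γ > 0`, with `e_K := E·(γ·L^{−(K+1)})²` (`E ≥ 1` as in the module docstring) one has `e_K ≥ 0`,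
`Σ_K √e_K < ∞` (geometric), and the step-`(K+1)` Gibbs mass of `{U | ¬PlaqSmall ((γ ε_{K+1})^a) U}` is `≤ e_K` (single-plaquette tail by reflection
positivity + chessboard, union bound over the bare plaquettes, `β·θ² = β^{1−2a}`, stretched exponential beats `β^{19/2}`; the finitely many cut-offs
with `β_{K+1} < 1` are covered by `E ≥ 1`).  No summit and no rung is proved. [cite: Balaban1985UV3, (7) p.257] -/
theorem topRegularMass_proof : Summit.QuantumFields.YangMills.Theses.TransportPerturbation.TopRegularMass := by
  unfold Summit.QuantumFields.YangMills.Theses.TransportPerturbation.TopRegularMass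
  intro a ha0 ha F γ hγ
  obtain ⟨c, hc, _hc1, hplaq⟩ := gibbsMeasure_real_dist1_ge_le (N := 2)
  have hs : 0 < 1 - 2 * a := by linarith
  obtain ⟨C₁, hC₁, hbeat⟩ := rpow_mul_exp_neg_rpow_le hs (q := 19 / 2) (by norm_num)
  have hL1 : (1 : ℝ) < F.L := by exact_mod_cast F.hL.2
  have hL0 : (0 : ℝ) < F.L := one_pos.trans hL1
  -- the constants
  set A : ℝ := 72 * (F.L : ℝ) ^ (3 * F.m) * γ ^ 3 * (2 * Real.exp 24 * (c ^ 3)⁻¹) with hA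
  have hA0 : 0 ≤ A := by positivity
  set E : ℝ := A * C₁ + 1 with hE
  have hE1 : 1 ≤ E := by have : 0 ≤ A * C₁ := mul_nonneg hA0 hC₁; linarith
  have hE0 : 0 ≤ E := zero_le_one.trans hE1
  -- `t_K = γ ε_{K+1} = β_{K+1}⁻¹`
  set t : ℕ → ℝ := fun K => γ * ((F.L : ℝ)⁻¹) ^ (K + 1) with ht
  have ht0 : ∀ K, 0 < t K := fun K => by rw [ht]; positivity
  refine ⟨fun K => E * t K ^ 2, fun K => by positivity, ?_, fun K => ?_⟩
  · -- `√e_K = √E · γ · L⁻¹ · (L⁻¹)^K` is summable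
    have hgeom : Summable fun K : ℕ => (Real.sqrt E * (γ * (F.L : ℝ)⁻¹)) * ((F.L : ℝ)⁻¹) ^ K :=
      (summable_geometric_of_lt_one (inv_nonneg.mpr hL0.le) (inv_lt_one_of_one_lt₀ hL1)).mul_left _
    refine hgeom.congr fun K => ?_
    show Real.sqrt E * (γ * (F.L : ℝ)⁻¹) * ((F.L : ℝ)⁻¹) ^ K = Real.sqrt (E * t K ^ 2)
    rw [Real.sqrt_mul hE0, Real.sqrt_sq (ht0 K).le, ht]
    ring
  · -- the mass bound for the `(K+1)`-st approximation
    set β : ℝ := (F.scheme (ExpMeanLog.expMeanLogSU : LoopAverage (Matrix.specialUnitaryGroup (Fin 2) ℂ)) γ).β (K + 1) with hβdef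
    have hβt : β = (t K)⁻¹ := rfl
    have hβ0 : 0 < β := by rw [hβt]; exact inv_pos.mpr (ht0 K)
    haveI : IsProbabilityMeasure (T4GenFunBounds.gibbsMeasure (G := Matrix.specialUnitaryGroup (Fin 2) ℂ) (F.P (K + 1)) β) :=
      T4GenFunBounds.isProbabilityMeasure_gibbsMeasure _ hβ0.le
    -- the threshold `θ = t^a` and `β θ² = β^{1−2a}`
    have hθt : (γ * (F.P (K + 1)).eps) ^ a = t K ^ a := rfl
    have hθ0 : 0 ≤ t K ^ a := Real.rpow_nonneg (ht0 K).le a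
    have hβθ : β * (t K ^ a) ^ 2 = β ^ (1 - 2 * a) := by rw [hβt]; exact inv_mul_rpow_sq (ht0 K)
    rw [hθt]
    by_cases hβ1 : 1 ≤ β
    · -- `β ≥ 1`: union bound + single-plaquette tail + arithmetic
      have hunion := real_not_plaqSmall_comp_le_sum (T4GenFunBounds.gibbsMeasure (F.P (K + 1)) β)
        (fun U : GaugeField (F.P (K + 1)) 0 (Matrix.specialUnitaryGroup (Fin 2) ℂ) => U) (t K ^ a)
      refine hunion.trans ?_
      have hcard2 : Fintype.card {q : Fin (F.P (K + 1)).d × Fin (F.P (K + 1)).d // q.1 < q.2} = 3 := by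
        rw [show (F.P (K + 1)).d = 3 from rfl]; decide
      have hd3 : (F.P (K + 1)).d = 3 := rfl
      have hterm : ∀ p : Plaq (F.P (K + 1)) 0,
          (T4GenFunBounds.gibbsMeasure (F.P (K + 1)) β).real
              {U : GaugeField (F.P (K + 1)) 0 (Matrix.specialUnitaryGroup (Fin 2) ℂ) | t K ^ a ≤ dist1 (GaugeField.plaqHol U p)} ≤
            2 * Real.exp 24 * (c ^ 3)⁻¹ * Real.sqrt β ^ 9 * Real.exp (-(β ^ (1 - 2 * a) / 4)) := by
        intro p
        have hp1 := hplaq (F.P (K + 1)) β hβ1 (t K ^ a) hθ0 p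
        rw [hcard2, hd3, hβθ] at hp1
        refine hp1.trans (le_of_eq ?_)
        norm_num
      refine (Finset.sum_le_sum fun p _ => hterm p).trans ?_
      rw [Finset.sum_const, Finset.card_univ, nsmul_eq_mul]
      -- `#Plaq ≤ 72 L^{3m} (L^{K+1})³ = 72 L^{3m} γ³ β³`
      have hLK : (F.L : ℝ) ^ (K + 1) = γ * β := by
        rw [hβt]
        show (F.L : ℝ) ^ (K + 1) = γ * (γ * ((F.L : ℝ)⁻¹) ^ (K + 1))⁻¹
        rw [mul_inv, inv_pow, inv_inv, ← mul_assoc, mul_inv_cancel₀ hγ.ne', one_mul]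
      have hcard : (Fintype.card (Plaq (F.P (K + 1)) 0) : ℝ) ≤ 72 * (F.L : ℝ) ^ (3 * F.m) * (γ * β) ^ 3 := by
        have h := card_plaq_le_height F (K := K + 1) (j := 0) (Nat.zero_le _)
        rwa [Nat.sub_zero, hLK] at h
      have hT0 : 0 ≤ 2 * Real.exp 24 * (c ^ 3)⁻¹ * Real.sqrt β ^ 9 * Real.exp (-(β ^ (1 - 2 * a) / 4)) := by positivity
      refine (mul_le_mul_of_nonneg_right hcard hT0).trans ?_
      -- stretched exponential beats `β^{19/2}`
      have hpow : β ^ 3 * Real.sqrt β ^ 9 = β ^ (19 / 2 : ℝ) * β ^ (-2 : ℝ) := pow_three_mul_sqrt_pow_nine hβ0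
      have hb := hbeat β hβ1
      have hβm2 : β ^ (-2 : ℝ) = t K ^ 2 := by
        rw [Real.rpow_neg hβ0.le, Real.rpow_two, hβt, inv_pow, inv_inv]
      have hkey : β ^ 3 * Real.sqrt β ^ 9 * Real.exp (-(β ^ (1 - 2 * a) / 4)) ≤ C₁ * t K ^ 2 := by
        rw [hpow, ← hβm2]
        have hm2 : 0 ≤ β ^ (-2 : ℝ) := Real.rpow_nonneg hβ0.le _
        calc β ^ (19 / 2 : ℝ) * β ^ (-2 : ℝ) * Real.exp (-(β ^ (1 - 2 * a) / 4))
            = β ^ (-2 : ℝ) * (β ^ (19 / 2 : ℝ) * Real.exp (-(β ^ (1 - 2 * a) / 4))) := by ring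
          _ ≤ β ^ (-2 : ℝ) * C₁ := mul_le_mul_of_nonneg_left hb hm2
          _ = C₁ * β ^ (-2 : ℝ) := mul_comm _ _
      calc 72 * (F.L : ℝ) ^ (3 * F.m) * (γ * β) ^ 3 *
            (2 * Real.exp 24 * (c ^ 3)⁻¹ * Real.sqrt β ^ 9 * Real.exp (-(β ^ (1 - 2 * a) / 4)))
          = A * (β ^ 3 * Real.sqrt β ^ 9 * Real.exp (-(β ^ (1 - 2 * a) / 4))) := by rw [hA]; ring
        _ ≤ A * (C₁ * t K ^ 2) := mul_le_mul_of_nonneg_left hkey hA0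
        _ ≤ E * t K ^ 2 := by
            rw [hE]
            nlinarith [sq_nonneg (t K), mul_nonneg hA0 hC₁]
    · -- `β < 1`: a probability bound, `t = β⁻¹ > 1`
      have hβ1' : β < 1 := lt_of_not_ge hβ1
      have ht1 : 1 ≤ t K := by
        have : t K = β⁻¹ := by rw [hβt, inv_inv]
        rw [this]
        exact (one_le_inv₀ hβ0).mpr hβ1'.le
      have ht2 : 1 ≤ t K ^ 2 := by nlinarith
      calc (T4GenFunBounds.gibbsMeasure (F.P (K + 1)) β).real
            {U : GaugeField (F.P (K + 1)) 0 (Matrix.specialUnitaryGroup (Fin 2) ℂ) | ¬ PlaqSmall (t K ^ a) U}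
          ≤ 1 := measureReal_le_one
        _ ≤ E := hE1
        _ ≤ E * t K ^ 2 := le_mul_of_one_le_right hE0 ht2

end Summit.QuantumFields.YangMills.Theorems.TransportPerturbationRegularShadow

end
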